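import Literature.Geometry.Riemannian.RoundCylinderFour
import Literature.Geometry.Riemannian.ShrinkingRoundSphereFour
import Literature.Geometry.Riemannian.RoundSphereVolume
import Literature.Geometry.Lorentzian.VolumeChartIntegral
import HarnessLib

/-!
# The punctured shrinking sphere `S⁴(√6) ∖ {pt}` as the conformally flat metric `96 (|y|²+4)⁻² δ`
# on `ℝ⁴` (topic `Geometry/Riemannian`)

Under stereographic projection from the deleted point, the round sphere of radius `√6` minus a
point is isometric to `ℝ⁴` with the conformally flat metric
`g_p = 6 · (4/(|y|²+4))² δ = 96 (|y|²+4)⁻² δ = e^{2w} δ`, `w = log (4√6) − log (|y|²+4)` (Lee 2018,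
Ch. 3: `(σ⁻¹)^* g̊ = 4|du|²/(1+|u|²)²` in the unscaled normalisation; here the equator sits at
`|y| = 2`, as in Mathlib's `stereoInvFunAux` and the tree's `chartGramMatrix_roundMetric`). It is an
INCOMPLETE Einstein metric on the non-compact manifold `ℝ⁴` with `Ric = ½ g_p`, `R = 2`, so with
`f ≡ 2` it satisfies every clause of a normalised gradient shrinking Ricci soliton except
completeness, and its weighted volume is that of `S⁴(√6)`:
`∫ e^{-2} dV = e^{-2} · 6² · 8π²/3 = 96π² e^{-2}` (`Θ(S⁴) = 6/e² = .812`, Cao–Hamilton–Ilmanen 2004,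
§4). Built exactly like the round cylinder (`RoundCylinderFour.lean`), on `ℝ⁴ = ↥(⊤ : Opens ℝ⁴)` so
that the `OpensChart` dictionary applies:

* `wE`, `exp_two_wE`, `fderiv_wE_apply`, `fderiv_fderiv_wE_apply` — the exponent and its calculus;
* `flatW`, `punctP` — the flat metric and `g_p` as smooth `PseudoRiemannianMetric`s on `W4 = ↥⊤`
  (the representative `G0`, the standard basis `e4` and its sums are reused from `RoundCylinderFour`);
* **`ricci_punctP`** (`Ric(g_p) = ½ g_p`, Besse's conformal law), **`scalarCurvature_punctP`**
  (`R = 2`), `soliton_two`, `normalisation_two`, `scalarCurvature_ne_zero`;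
* `NoncompactSpace W4`, `ConnectedSpace W4`;
* `chartGramMatrix_hP`, `sqrt_det_chartGramMatrix_hP` (`√det = 36 (4/(|y|²+4))⁴`) and
  **`lintegral_exp_neg_two`**: `∫ e^{-2} dV_{g_p} = e^{-2} · 6² · 8π²/3`, by the chart formula and the
  tree's `integral_conformalFactor_four` (`RoundSphereVolume.lean`).

Everything is proved; no named facts. Written for the refuter's lemma "completeness is
load-bearing" for crux `EntropyRung.NoncompactShrinkerGap` (SmoothPoincare4).

## References

* J. M. Lee, *Introduction to Riemannian Manifolds*, 2nd ed., Springer 2018, Ch. 3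
  (stereographic coordinates). [Lee2018]
* H.-D. Cao, R. S. Hamilton, T. Ilmanen, arXiv:math/0404165 (2004), §4. [CaoHamiltonIlmanen2004]
* A. L. Besse, *Einstein manifolds*, Springer 1987, Thm. 1.159. [Besse1987]
-/

noncomputable section

open Bundle Set Function Filter Manifold Metric Module TopologicalSpace
open scoped Manifold ContDiff Topology RealInnerProductSpace ENNReal NNReal

namespace Literature.Geometry.Riemannian

open Lorentzian Lorentzian.PseudoRiemannianMetric

namespace PuncturedSphereFour

open RoundCylinderFour (G0 e4 e4_apply sum_inner_e4_sq sum_inner_e4_e4)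

/-- `ℝ⁴` as the (improper) open subset `⊤`, so that the `OpensChart` dictionary applies verbatim. [folklore] -/
abbrev whole : Opens EuclideanFour := ⊤

/-- The manifold `ℝ⁴ = ↥⊤`. [folklore] -/
abbrev W4 : Type := whole

/-- Support lemma `sq_add_four_pos` of the punctured-sphere model `(ℝ⁴, 96(|y|²+4)⁻²δ)` (see the module docstring). [folklore] -/
theorem sq_add_four_pos (y : EuclideanFour) : 0 < ‖y‖ ^ 2 + 4 := by positivity

/-! ### The conformal exponent `w = log (4√6) − log (|y|² + 4)`, `e^{2w} = 96/(|y|²+4)²` -/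

/-- Support lemma `wE` of the punctured-sphere model `(ℝ⁴, 96(|y|²+4)⁻²δ)` (see the module docstring). [folklore] -/
def wE (y : EuclideanFour) : ℝ := Real.log (4 * Real.sqrt 6) - Real.log (‖y‖ ^ 2 + 4)

/-- Support lemma `exp_two_wE` of the punctured-sphere model `(ℝ⁴, 96(|y|²+4)⁻²δ)` (see the module docstring). [folklore] -/
theorem exp_two_wE (y : EuclideanFour) : Real.exp (2 * wE y) = 96 / (‖y‖ ^ 2 + 4) ^ 2 := by
  have hs := sq_add_four_pos y
  have h46 : 0 < 4 * Real.sqrt 6 := by positivity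
  have h : 2 * wE y = Real.log ((4 * Real.sqrt 6) ^ 2) - Real.log ((‖y‖ ^ 2 + 4) ^ 2) := by
    rw [wE, Real.log_pow, Real.log_pow]; push_cast; ring
  rw [h, Real.exp_sub, Real.exp_log (by positivity), Real.exp_log (by positivity)]
  congr 1
  rw [mul_pow, Real.sq_sqrt (by norm_num)]; norm_num

/-- Support lemma `contDiff_wE` of the punctured-sphere model `(ℝ⁴, 96(|y|²+4)⁻²δ)` (see the module docstring). [folklore] -/
theorem contDiff_wE {n : ℕ∞ω} : ContDiff ℝ n wE := by
  refine contDiff_const.sub ?_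
  exact (contDiff_norm_sq ℝ |>.add contDiff_const).log fun y ↦ (sq_add_four_pos y).ne'

/-- Support lemma `hasFDerivAt_wE` of the punctured-sphere model `(ℝ⁴, 96(|y|²+4)⁻²δ)` (see the module docstring). [folklore] -/
theorem hasFDerivAt_wE (y : EuclideanFour) :
    HasFDerivAt wE (-((‖y‖ ^ 2 + 4)⁻¹) • (2 • innerSL ℝ y)) y := by
  have hs := (sq_add_four_pos y).ne'
  have h1 : HasFDerivAt (fun y : EuclideanFour ↦ ‖y‖ ^ 2 + 4) (2 • innerSL ℝ y) y :=
    (hasStrictFDerivAt_norm_sq y).hasFDerivAt.add_const 4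
  have h2 := (Real.hasDerivAt_log hs).comp_hasFDerivAt y h1
  have h3 : HasFDerivAt wE (0 - (‖y‖ ^ 2 + 4)⁻¹ • (2 • innerSL ℝ y)) y := by
    exact (hasFDerivAt_const _ y).sub h2
  refine h3.congr_fderiv ?_
  rw [zero_sub, neg_smul]

/-- Support lemma `fderiv_wE_apply` of the punctured-sphere model `(ℝ⁴, 96(|y|²+4)⁻²δ)` (see the module docstring). [folklore] -/
theorem fderiv_wE_apply (y v : EuclideanFour) :
    fderiv ℝ wE y v = -(2 * ⟪y, v⟫) / (‖y‖ ^ 2 + 4) := by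
  rw [(hasFDerivAt_wE y).fderiv, _root_.smul_apply, _root_.smul_apply, innerSL_apply_apply, smul_eq_mul,
    nsmul_eq_mul, Nat.cast_ofNat]
  ring

/-- Support lemma `fderiv_wE_eq` of the punctured-sphere model `(ℝ⁴, 96(|y|²+4)⁻²δ)` (see the module docstring). [folklore] -/
theorem fderiv_wE_eq : fderiv ℝ wE = fun y ↦ -((‖y‖ ^ 2 + 4)⁻¹) • (2 • innerSL ℝ y) :=
  funext fun y ↦ (hasFDerivAt_wE y).fderiv

/-- Support lemma `hasFDerivAt_dwE` of the punctured-sphere model `(ℝ⁴, 96(|y|²+4)⁻²δ)` (see the module docstring). [folklore] -/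
theorem hasFDerivAt_dwE (x : EuclideanFour) :
    HasFDerivAt (fun y : EuclideanFour ↦ -((‖y‖ ^ 2 + 4)⁻¹) • (2 • innerSL ℝ y))
      ((-((‖x‖ ^ 2 + 4)⁻¹)) • (2 • (innerSL ℝ : EuclideanFour →L[ℝ] EuclideanFour →L[ℝ] ℝ)) +
        ((((‖x‖ ^ 2 + 4)⁻¹) ^ 2) • (2 • innerSL ℝ x)).smulRight (2 • innerSL ℝ x)) x := by
  have hs := (sq_add_four_pos x).ne'
  have h1 : HasFDerivAt (fun y : EuclideanFour ↦ ‖y‖ ^ 2 + 4) (2 • innerSL ℝ x) x :=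
    (hasStrictFDerivAt_norm_sq x).hasFDerivAt.add_const 4
  have h2 : HasFDerivAt (fun y : EuclideanFour ↦ -((‖y‖ ^ 2 + 4)⁻¹))
      ((((‖x‖ ^ 2 + 4)⁻¹) ^ 2) • (2 • innerSL ℝ x)) x := by
    have h := ((hasDerivAt_inv hs).comp_hasFDerivAt x h1).neg
    refine h.congr_fderiv ?_
    ext v
    simp only [_root_.neg_apply, _root_.smul_apply, smul_eq_mul, nsmul_eq_mul, Nat.cast_ofNat,
      innerSL_apply_apply]
    field_simp
  have h3 : HasFDerivAt (fun y : EuclideanFour ↦ (2 • innerSL ℝ y : EuclideanFour →L[ℝ] ℝ))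
      (2 • (innerSL ℝ : EuclideanFour →L[ℝ] EuclideanFour →L[ℝ] ℝ)) x :=
    ((innerSL ℝ : EuclideanFour →L[ℝ] EuclideanFour →L[ℝ] ℝ).hasFDerivAt).const_smul 2
  exact h2.smul h3

/-- Support lemma `fderiv_fderiv_wE_apply` of the punctured-sphere model `(ℝ⁴, 96(|y|²+4)⁻²δ)` (see the module docstring). [folklore] -/
theorem fderiv_fderiv_wE_apply (x Y Z : EuclideanFour) :
    fderiv ℝ (fderiv ℝ wE) x Y Z =
      -(2 * ⟪Y, Z⟫) / (‖x‖ ^ 2 + 4) + 4 * ⟪x, Y⟫ * ⟪x, Z⟫ / (‖x‖ ^ 2 + 4) ^ 2 := by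
  have hs := (sq_add_four_pos x).ne'
  rw [fderiv_wE_eq, (hasFDerivAt_dwE x).fderiv]
  simp only [add_apply, _root_.smul_apply, innerSL_apply_apply, smul_eq_mul,
    ContinuousLinearMap.smulRight_apply, nsmul_eq_mul, Nat.cast_ofNat]
  have e : (innerSL ℝ : EuclideanFour →L[ℝ] EuclideanFour →L[ℝ] ℝ) Y Z = ⟪Y, Z⟫ := rfl
  rw [e]
  field_simp
  ring

/-! ### The metrics `δ` and `g_p = e^{2w} δ` on `ℝ⁴ = ↥⊤` -/

/-- Support lemma `Gp` of the punctured-sphere model `(ℝ⁴, 96(|y|²+4)⁻²δ)` (see the module docstring). [folklore] -/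
abbrev Gp : EuclideanFour → EuclideanFour →L[ℝ] EuclideanFour →L[ℝ] ℝ :=
  fun y ↦ Real.exp (2 * wE y) • innerSL ℝ (E := EuclideanFour)

/-- Support lemma `contDiffOn_Gp` of the punctured-sphere model `(ℝ⁴, 96(|y|²+4)⁻²δ)` (see the module docstring). [folklore] -/
theorem contDiffOn_Gp : ContDiffOn ℝ ∞ Gp univ :=
  contDiffOn_smul_const' (Real.contDiff_exp.comp (contDiff_const.mul contDiff_wE)).contDiffOn
    (innerSL ℝ (E := EuclideanFour))

/-- Support lemma `flatInner` of the punctured-sphere model `(ℝ⁴, 96(|y|²+4)⁻²δ)` (see the module docstring). [folklore] -/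
def flatInner (y : W4) :
    TangentSpace 𝓘(ℝ, EuclideanFour) y →L[ℝ] TangentSpace 𝓘(ℝ, EuclideanFour) y →L[ℝ] ℝ :=
  show EuclideanFour →L[ℝ] EuclideanFour →L[ℝ] ℝ from innerSL ℝ (E := EuclideanFour)

/-- Support lemma `punctInner` of the punctured-sphere model `(ℝ⁴, 96(|y|²+4)⁻²δ)` (see the module docstring). [folklore] -/
def punctInner (y : W4) :
    TangentSpace 𝓘(ℝ, EuclideanFour) y →L[ℝ] TangentSpace 𝓘(ℝ, EuclideanFour) y →L[ℝ] ℝ :=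
  show EuclideanFour →L[ℝ] EuclideanFour →L[ℝ] ℝ from
    Real.exp (2 * wE (y : EuclideanFour)) • innerSL ℝ (E := EuclideanFour)

/-- Support lemma `flatW` of the punctured-sphere model `(ℝ⁴, 96(|y|²+4)⁻²δ)` (see the module docstring). [folklore] -/
def flatW : PseudoRiemannianMetric 𝓘(ℝ, EuclideanFour) ∞ EuclideanFour
    (TangentSpace 𝓘(ℝ, EuclideanFour) : W4 → Type _) where
  val := flatInner
  symm y v w := by
    change @inner ℝ EuclideanFour _ v w = @inner ℝ EuclideanFour _ w v
    exact real_inner_comm _ _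
  nondegenerate y v hv := by
    have h : @inner ℝ EuclideanFour _ v v = 0 := hv v
    exact inner_self_eq_zero.mp h
  contMDiff := OpensSection.contMDiff_bilinSection whole _ contMDiff_const

/-- **The punctured shrinking sphere** `g_p = 96 (|y|²+4)⁻² δ` on `ℝ⁴` (`= σ_* (6 g_{S⁴})`, `σ` the
stereographic projection): smooth, Riemannian, incomplete. [folklore] -/
def punctP : PseudoRiemannianMetric 𝓘(ℝ, EuclideanFour) ∞ EuclideanFour
    (TangentSpace 𝓘(ℝ, EuclideanFour) : W4 → Type _) where
  val := punctInner
  symm y v w := by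
    change Real.exp (2 * wE y) * @inner ℝ EuclideanFour _ v w =
      Real.exp (2 * wE y) * @inner ℝ EuclideanFour _ w v
    rw [real_inner_comm]
  nondegenerate y v hv := by
    have h : Real.exp (2 * wE y) * @inner ℝ EuclideanFour _ v v = 0 := hv v
    rcases mul_eq_zero.mp h with h | h
    · exact absurd h (Real.exp_pos _).ne'
    · exact inner_self_eq_zero.mp h
  contMDiff := by
    refine OpensSection.contMDiff_bilinSection whole (fun y ↦ Gp y) ?_
    exact contDiffOn_Gp.contMDiffOn.comp_contMDiff contMDiff_subtype_val fun _ ↦ mem_univ _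

/-- Support lemma `flatW_val` of the punctured-sphere model `(ℝ⁴, 96(|y|²+4)⁻²δ)` (see the module docstring). [folklore] -/
theorem flatW_val (y : W4) : flatW.val y = G0 y := rfl
/-- Support lemma `punctP_val` of the punctured-sphere model `(ℝ⁴, 96(|y|²+4)⁻²δ)` (see the module docstring). [folklore] -/
theorem punctP_val (y : W4) : punctP.val y = Real.exp (2 * wE (y : EuclideanFour)) • G0 y := rfl
/-- Support lemma `flatW_apply` of the punctured-sphere model `(ℝ⁴, 96(|y|²+4)⁻²δ)` (see the module docstring). [folklore] -/
theorem flatW_apply (y : W4) (v w : EuclideanFour) : flatW.val y v w = ⟪v, w⟫ := rfl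

/-- Support lemma `punctP_apply` of the punctured-sphere model `(ℝ⁴, 96(|y|²+4)⁻²δ)` (see the module docstring). [folklore] -/
theorem punctP_apply (y : W4) (v w : EuclideanFour) :
    punctP.val y v w = 96 / (‖(y : EuclideanFour)‖ ^ 2 + 4) ^ 2 * ⟪v, w⟫ := by
  change Real.exp (2 * wE y) * ⟪v, w⟫ = _
  rw [exp_two_wE]

/-- Support lemma `isRiemannian_punctP` of the punctured-sphere model `(ℝ⁴, 96(|y|²+4)⁻²δ)` (see the module docstring). [folklore] -/
theorem isRiemannian_punctP : punctP.IsRiemannian := fun y v hv ↦ by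
  rw [punctP_apply]
  exact mul_pos (div_pos (by norm_num) (pow_pos (sq_add_four_pos _) 2)) (real_inner_self_pos.mpr hv)

/-- Levi-Civita instance for the flat metric `flatW` (the tree's general existence theorem). [folklore] -/
instance : flatW.HasLeviCivita := flatW.hasLeviCivita
/-- Levi-Civita instance for the punctured-sphere metric `punctP`. [folklore] -/
instance : punctP.HasLeviCivita := punctP.hasLeviCivita

/-! ### Flat base and basis sums (as in the cylinder file) -/

/-- Support lemma `ricci_flatW` of the punctured-sphere model `(ℝ⁴, 96(|y|²+4)⁻²δ)` (see the module docstring). [folklore] -/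
theorem ricci_flatW (x : W4) (Y Z : EuclideanFour) : flatW.ricci x Y Z = 0 := by
  rw [OpensChart.ricci_eq_ricAt flatW_val x, MetricCoord.ricAt_constMetric]; rfl

/-- Support lemma `scalarCurvature_flatW` of the punctured-sphere model `(ℝ⁴, 96(|y|²+4)⁻²δ)` (see the module docstring). [folklore] -/
theorem scalarCurvature_flatW (x : W4) : flatW.scalarCurvature x = 0 := by
  rw [OpensChart.scalarCurvature_eq_scalAt flatW_val x, MetricCoord.scalAt_constMetric]

/-- Support lemma `hessian_flatW` of the punctured-sphere model `(ℝ⁴, 96(|y|²+4)⁻²δ)` (see the module docstring). [folklore] -/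
theorem hessian_flatW (x : W4) {f : W4 → ℝ} {Φ : EuclideanFour → ℝ} (hf : ∀ y : W4, f y = Φ y)
    (hΦ : ContDiffAt ℝ 2 Φ x) (Y Z : EuclideanFour) :
    flatW.hessian f x Y Z = fderiv ℝ (fderiv ℝ Φ) x Y Z := by
  rw [OpensChart.hessian_eq_hessAt flatW_val x hf hΦ, MetricCoord.hessAt_constMetric]

/-- Support lemma `dalembertian_flatW` of the punctured-sphere model `(ℝ⁴, 96(|y|²+4)⁻²δ)` (see the module docstring). [folklore] -/
theorem dalembertian_flatW (x : W4) {f : W4 → ℝ} {Φ : EuclideanFour → ℝ}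
    (hf : ∀ y : W4, f y = Φ y) (hΦ : ContDiffAt ℝ 2 Φ x) :
    flatW.dalembertian f x = ∑ i, fderiv ℝ (fderiv ℝ Φ) x (e4 i) (e4 i) := by
  rw [OpensChart.dalembertian_eq_lapAt flatW_val x hf hΦ,
    MetricCoord.lapAt_constMetric _ e4 innerSL_basisFun_orthonormal]

/-- Support lemma `innerDual_flatW` of the punctured-sphere model `(ℝ⁴, 96(|y|²+4)⁻²δ)` (see the module docstring). [folklore] -/
theorem innerDual_flatW (x : W4) (α β : EuclideanFour →L[ℝ] ℝ) :
    flatW.innerDual x (α : EuclideanFour →ₗ[ℝ] ℝ) (β : EuclideanFour →ₗ[ℝ] ℝ) =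
      ∑ i, α (e4 i) * β (e4 i) := by
  rw [OpensChart.innerDual_eq_sharpAt flatW_val x,
    MetricCoord.apply_sharpAt_constMetric _ e4 innerSL_basisFun_orthonormal
      (fun v w ↦ real_inner_comm w v)]

/-! ### `w` on the manifold, Laplacian and gradient of `w` -/

/-- Support lemma `wP` of the punctured-sphere model `(ℝ⁴, 96(|y|²+4)⁻²δ)` (see the module docstring). [folklore] -/
def wP (y : W4) : ℝ := wE y

/-- Support lemma `wP_eq` of the punctured-sphere model `(ℝ⁴, 96(|y|²+4)⁻²δ)` (see the module docstring). [folklore] -/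
theorem wP_eq (y : W4) : wP y = wE y := rfl

/-- Support lemma `mvfderiv_wP` of the punctured-sphere model `(ℝ⁴, 96(|y|²+4)⁻²δ)` (see the module docstring). [folklore] -/
theorem mvfderiv_wP (x : W4) (v : EuclideanFour) :
    mvfderiv 𝓘(ℝ, EuclideanFour) wP x v = -(2 * ⟪(x : EuclideanFour), v⟫) / (‖(x : EuclideanFour)‖ ^ 2 + 4) := by
  rw [OpensChart.mvfderiv_eq x wP wE wP_eq ((hasFDerivAt_wE _).differentiableAt) v, fderiv_wE_apply]

/-- Support lemma `laplacian_wE` of the punctured-sphere model `(ℝ⁴, 96(|y|²+4)⁻²δ)` (see the module docstring). [folklore] -/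
theorem laplacian_wE (x : W4) :
    ∑ i, fderiv ℝ (fderiv ℝ wE) x (e4 i) (e4 i) =
      -8 / (‖(x : EuclideanFour)‖ ^ 2 + 4) + 4 * ‖(x : EuclideanFour)‖ ^ 2 / (‖(x : EuclideanFour)‖ ^ 2 + 4) ^ 2 := by
  have hs := (sq_add_four_pos (x : EuclideanFour)).ne'
  have h : ∀ i, fderiv ℝ (fderiv ℝ wE) x (e4 i) (e4 i) =
      -(2 / (‖(x : EuclideanFour)‖ ^ 2 + 4)) * ⟪(e4 i : EuclideanFour), e4 i⟫ +
        (4 / (‖(x : EuclideanFour)‖ ^ 2 + 4) ^ 2) * ⟪(x : EuclideanFour), e4 i⟫ ^ 2 := by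
    intro i; rw [fderiv_fderiv_wE_apply]; ring
  simp_rw [h, Finset.sum_add_distrib, ← Finset.mul_sum, sum_inner_e4_e4, sum_inner_e4_sq]
  ring

/-- Support lemma `gradnormSq_wE` of the punctured-sphere model `(ℝ⁴, 96(|y|²+4)⁻²δ)` (see the module docstring). [folklore] -/
theorem gradnormSq_wE (x : W4) :
    ∑ i, fderiv ℝ wE x (e4 i) * fderiv ℝ wE x (e4 i) =
      4 * ‖(x : EuclideanFour)‖ ^ 2 / (‖(x : EuclideanFour)‖ ^ 2 + 4) ^ 2 := by
  have h : ∀ i, fderiv ℝ wE x (e4 i) * fderiv ℝ wE x (e4 i) =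
      (4 / (‖(x : EuclideanFour)‖ ^ 2 + 4) ^ 2) * ⟪(x : EuclideanFour), e4 i⟫ ^ 2 := by
    intro i; rw [fderiv_wE_apply]; field_simp; ring
  simp_rw [h, ← Finset.mul_sum, sum_inner_e4_sq]
  field_simp

/-! ### `Ric(g_p) = ½ g_p` (Einstein), `R(g_p) = 2` -/

/-- Support lemma `ricci_punctP` of the punctured-sphere model `(ℝ⁴, 96(|y|²+4)⁻²δ)` (see the module docstring). [folklore] -/
theorem ricci_punctP (x : W4) (Y Z : EuclideanFour) :
    punctP.ricci x Y Z = (1 / 2 : ℝ) * punctP.val x Y Z := by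
  have hs := (sq_add_four_pos (x : EuclideanFour)).ne'
  have hu : ContDiffOn ℝ ∞ wE (whole : Set EuclideanFour) := contDiff_wE.contDiffOn
  have h := OpensChart.ricci_conformalRepr_exp flatW_val punctP_val hu (w := wP) wP_eq x Y Z
  have hmv : (mvfderiv 𝓘(ℝ, EuclideanFour) wP x).toLinearMap =
      ((fderiv ℝ wE x : EuclideanFour →L[ℝ] ℝ) : EuclideanFour →ₗ[ℝ] ℝ) := by
    apply LinearMap.ext; intro v
    exact OpensChart.mvfderiv_eq x wP wE wP_eq ((hasFDerivAt_wE _).differentiableAt) v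
  rw [h, ricci_flatW, hessian_flatW x wP_eq contDiff_wE.contDiffAt, fderiv_fderiv_wE_apply,
    mvfderiv_wP, mvfderiv_wP, dalembertian_flatW x wP_eq contDiff_wE.contDiffAt, laplacian_wE, hmv,
    innerDual_flatW, gradnormSq_wE, flatW_apply, finrank_euclideanSpace_fin, punctP_apply]
  push_cast
  field_simp
  ring

/-- Support lemma `scalarCurvature_punctP` of the punctured-sphere model `(ℝ⁴, 96(|y|²+4)⁻²δ)` (see the module docstring). [folklore] -/
theorem scalarCurvature_punctP (x : W4) : punctP.scalarCurvature x = 2 := by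
  have hs := (sq_add_four_pos (x : EuclideanFour)).ne'
  have hu : ContDiffOn ℝ ∞ wE (whole : Set EuclideanFour) := contDiff_wE.contDiffOn
  have h := OpensChart.scalarCurvature_conformalRepr_exp flatW_val punctP_val hu (w := wP) wP_eq x
  have hmv : (mvfderiv 𝓘(ℝ, EuclideanFour) wP x).toLinearMap =
      ((fderiv ℝ wE x : EuclideanFour →L[ℝ] ℝ) : EuclideanFour →ₗ[ℝ] ℝ) := by
    apply LinearMap.ext; intro v
    exact OpensChart.mvfderiv_eq x wP wE wP_eq ((hasFDerivAt_wE _).differentiableAt) v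
  rw [h, scalarCurvature_flatW, dalembertian_flatW x wP_eq contDiff_wE.contDiffAt, laplacian_wE, hmv,
    innerDual_flatW, gradnormSq_wE, finrank_euclideanSpace_fin, wP_eq, exp_two_wE]
  push_cast
  field_simp
  ring

/-! ### The soliton structure with `f ≡ 2` -/

/-- Support lemma `soliton_two` of the punctured-sphere model `(ℝ⁴, 96(|y|²+4)⁻²δ)` (see the module docstring). [folklore] -/
theorem soliton_two (x : W4) (X Y : TangentSpace 𝓘(ℝ, EuclideanFour) x) :
    punctP.ricci x X Y + punctP.hessian (fun _ ↦ (2 : ℝ)) x X Y = (1 / 2 : ℝ) * punctP.val x X Y := by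
  rw [ricci_punctP, punctP.hessian_constFun, LinearMap.zero_apply, LinearMap.zero_apply, add_zero]

/-- Support lemma `normalisation_two` of the punctured-sphere model `(ℝ⁴, 96(|y|²+4)⁻²δ)` (see the module docstring). [folklore] -/
theorem normalisation_two (x : W4) :
    punctP.scalarCurvature x + punctP.gradSq (fun _ ↦ (2 : ℝ)) x = 2 := by
  rw [scalarCurvature_punctP, PseudoRiemannianMetric.gradSq_const, add_zero]

/-- Support lemma `scalarCurvature_ne_zero` of the punctured-sphere model `(ℝ⁴, 96(|y|²+4)⁻²δ)` (see the module docstring). [folklore] -/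
theorem scalarCurvature_ne_zero (x : W4) : punctP.scalarCurvature x ≠ 0 := by
  rw [scalarCurvature_punctP]; norm_num

/-! ### Topology of `↥⊤` -/

/-- `W4 = ℝ⁴` is non-compact (its image `univ ⊆ ℝ⁴` is unbounded). [folklore] -/
instance : NoncompactSpace W4 := by
  refine ⟨fun hc ↦ ?_⟩
  have hK : IsCompact ((Subtype.val : W4 → EuclideanFour) '' univ) := hc.image continuous_subtype_val
  rw [image_univ, Subtype.range_coe_subtype] at hK
  have huniv : Bornology.IsBounded (univ : Set EuclideanFour) := by
    have hb := hK.isBounded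
    refine hb.subset fun y _ ↦ ?_
    change y ∈ (whole : Opens EuclideanFour)
    trivial
  exact NormedSpace.unbounded_univ ℝ EuclideanFour huniv

/-- `W4 = ℝ⁴` is connected. [folklore] -/
instance : ConnectedSpace W4 := by
  have h : IsConnected ((whole : Opens EuclideanFour) : Set EuclideanFour) := by
    change IsConnected (univ : Set EuclideanFour)
    exact isConnected_univ
  exact isConnected_iff_connectedSpace.mp h

open _root_.MeasureTheory _root_.MeasureTheory.Measure

/-! ### The weighted volume: `∫ e^{-2} dV_{g_p} = e^{-2} · 36 · 8π²/3 = 96 π² e^{-2}` -/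

/-- Support lemma `hP` of the punctured-sphere model `(ℝ⁴, 96(|y|²+4)⁻²δ)` (see the module docstring). [folklore] -/
abbrev hP : ContMDiffRiemannianMetric 𝓘(ℝ, EuclideanFour) ∞ EuclideanFour
    (TangentSpace 𝓘(ℝ, EuclideanFour) : W4 → Type _) :=
  punctP.toContMDiffRiemannianMetric isRiemannian_punctP

/-- Support lemma `chartGramMatrix_hP` of the punctured-sphere model `(ℝ⁴, 96(|y|²+4)⁻²δ)` (see the module docstring). [folklore] -/
theorem chartGramMatrix_hP (x₀ : W4) (y : EuclideanFour) :
    chartGramMatrix hP x₀ y = Real.exp (2 * wE y) • (1 : Matrix (Fin 4) (Fin 4) ℝ) := by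
  have hy : y ∈ (whole : Set EuclideanFour) := trivial
  have hyt : y ∈ (extChartAt 𝓘(ℝ, EuclideanFour) x₀).target := by
    rw [OpensChart.extChartAt_target]; exact hy
  have hsv : ((extChartAt 𝓘(ℝ, EuclideanFour) x₀).symm y : EuclideanFour) = y :=
    OpensChart.extChartAt_symm_val x₀ hy
  ext i j
  rw [chartGramMatrix_eq_inner_symmL hP x₀ hyt i j, OpensSection.symmL_apply, OpensSection.symmL_apply]
  change punctP.val ((extChartAt 𝓘(ℝ, EuclideanFour) x₀).symm y) (EuclideanSpace.single i 1)
    (EuclideanSpace.single j 1) = _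
  change Real.exp (2 * wE ((extChartAt 𝓘(ℝ, EuclideanFour) x₀).symm y : EuclideanFour)) *
    ⟪(EuclideanSpace.single i (1 : ℝ) : EuclideanFour), EuclideanSpace.single j 1⟫ = _
  rw [hsv, Matrix.smul_apply, Matrix.one_apply, smul_eq_mul]
  simp [EuclideanSpace.inner_single_left]

/-- Support lemma `sqrt_det_chartGramMatrix_hP` of the punctured-sphere model `(ℝ⁴, 96(|y|²+4)⁻²δ)` (see the module docstring). [folklore] -/
theorem sqrt_det_chartGramMatrix_hP (x₀ : W4) (y : EuclideanFour) :
    Real.sqrt (chartGramMatrix hP x₀ y).det = 36 * (4 / (‖y‖ ^ 2 + 4)) ^ 4 := by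
  have hs := sq_add_four_pos y
  rw [chartGramMatrix_hP x₀, Matrix.det_smul, Matrix.det_one, mul_one, Fintype.card_fin, exp_two_wE]
  have hs' : ‖y‖ ^ 2 + 4 ≠ 0 := hs.ne'
  have h : (96 / (‖y‖ ^ 2 + 4) ^ 2) ^ 4 = (36 * (4 / (‖y‖ ^ 2 + 4)) ^ 4) ^ 2 := by
    field_simp; norm_num
  rw [h, Real.sqrt_sq (by positivity)]

/-- Support lemma `lintegral_exp_neg_two_eq` of the punctured-sphere model `(ℝ⁴, 96(|y|²+4)⁻²δ)` (see the module docstring). [folklore] -/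
theorem lintegral_exp_neg_two_eq :
    ∫⁻ _ : W4, ENNReal.ofReal (Real.exp (-(2 : ℝ))) ∂(riemannianMeasure hP) =
      ∫⁻ y : EuclideanFour, ENNReal.ofReal (Real.exp (-2) * (36 * (4 / (‖y‖ ^ 2 + 4)) ^ 4)) := by
  haveI : Nonempty W4 := ⟨⟨0, trivial⟩⟩
  set x₀ : W4 := Classical.arbitrary W4
  have hmap := map_extChartAt_restrict_riemannianMeasure hP x₀
  rw [OpensChart.extChartAt_source, Measure.restrict_univ, OpensChart.extChartAt_coe,
    OpensChart.extChartAt_target] at hmap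
  have hemb : MeasurableEmbedding (Subtype.val : W4 → EuclideanFour) :=
    MeasurableEmbedding.subtype_coe MeasurableSet.univ
  have h1 : ∫⁻ _ : W4, ENNReal.ofReal (Real.exp (-(2 : ℝ))) ∂(riemannianMeasure hP) =
      ∫⁻ y, ENNReal.ofReal (Real.exp (-(2 : ℝ))) ∂((riemannianMeasure hP).map Subtype.val) := by
    rw [hemb.lintegral_map]
  rw [h1, hmap, lintegral_withDensity_eq_lintegral_mul₀
    (aemeasurable_ofReal_sqrt_det_chartGramMatrix hP x₀ |>.mono_measure (by
      rw [OpensChart.extChartAt_target])) (by exact measurable_const.aemeasurable)]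
  have hU : ((whole : Opens EuclideanFour) : Set EuclideanFour) = univ := rfl
  rw [hU, Measure.restrict_univ]
  refine lintegral_congr fun y ↦ ?_
  rw [Pi.mul_apply, sqrt_det_chartGramMatrix_hP x₀, ← ENNReal.ofReal_mul (by positivity), mul_comm]

/-- Support lemma `lintegral_exp_neg_two` of the punctured-sphere model `(ℝ⁴, 96(|y|²+4)⁻²δ)` (see the module docstring). [folklore] -/
theorem lintegral_exp_neg_two :
    ∫⁻ _ : W4, ENNReal.ofReal (Real.exp (-(2 : ℝ))) ∂(riemannianMeasure hP) =
      ENNReal.ofReal (Real.exp (-2) * (6 ^ 2 * (8 * Real.pi ^ 2 / 3))) := by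
  obtain ⟨hI, hint⟩ := integral_conformalFactor_four
  have hint2 : Integrable (fun y : EuclideanFour ↦ Real.exp (-2) * (36 * (4 / (‖y‖ ^ 2 + 4)) ^ 4)) :=
    (hint.const_mul 36).const_mul _
  rw [lintegral_exp_neg_two_eq, ← ofReal_integral_eq_lintegral_ofReal hint2
    (ae_of_all _ fun y ↦ by positivity), integral_const_mul, integral_const_mul, hI]
  ring_nf


end PuncturedSphereFour

end Literature.Geometry.Riemannian

end
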